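import Mathlib
import HarnessLib
import Literature.MathematicalPhysics.KineticTheory.LangevinChainGibbs
import Summits.AtomisticToContinuum.FouriersLaw.Theorems.JunctionLocalityInsertionCalculus

/-!
# Insertion identity toolbox, Ic: integration by parts against the Gibbs density

Support file for stub `stub_insertionIdentity` (line `thermalise-then-cut-probe-insertion`, crux
`stmt-AtomisticToContinuum-11748`). With `ρ = e^{−H/T}`: Green's identities for the OU thermostat
`S_i = T∂²_{p_i} − p_i∂_{p_i}` (`∫ (S_i u) v ρ = −T∫ ∂u ∂v ρ = ∫ u (S_i v) ρ`, one factor compactly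
supported), antisymmetry of the Liouville operator, `∫ (X_H φ) ρ = 0`, `∫ (S_i φ) ρ = 0`, and
`∫ (S_i ψ) F ρ = 0` for every `p_i`-translation-invariant weight `F` with `Fρ ∈ L¹` (the identity
behind `S_K ⟂ range Π_K`). All [folklore]. No definitions.
-/

noncomputable section

open scoped ContDiff Topology ENNReal NNReal Convolution Pointwise
open MeasureTheory ProbabilityTheory Filter Set Function
open Literature.MathematicalPhysics.KineticTheory.HeatConduction

namespace Summit.AtomisticToContinuum.FouriersLaw.Cruxes.SuperadditiveResistance.InsertionToolbox

local notation "uP" i' => ((0, Pi.single i' 1) : PhaseSpace _)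
local notation "uQ" i' => ((Pi.single i' 1, 0) : PhaseSpace _)

local notation "OU⟦" T' ";" i' ";" f' ";" x' "⟧" =>
  T' * partialP i' (partialP i' f') x' - Prod.snd (x' : PhaseSpace _) i' * partialP i' f' x'
local notation "XH⟦" P' ";" f' ";" x' "⟧" =>
  ∑ i, (Prod.snd (x' : PhaseSpace _) i * partialQ i f' x' -
    partialQ i (OscillatorChain.hamiltonian P' _) x' * partialP i f' x')
local notation "GEN⟦" P' ";" T' ";" c' ";" f' ";" x' "⟧" =>
  XH⟦P' ; f' ; x'⟧ + ∑ i, c' i * OU⟦T' ; i ; f' ; x'⟧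
local notation "CUT⟦" ω₂' ";" lam' ";" β' ";" γ' ";" n' ";" x' "⟧" =>
  Real.smoothTransition (2 - OscillatorChain.hamiltonian (pinnedChain ω₂' lam' β' γ') _ x' / ((n' : ℝ) + 1))

variable {L : ℕ}

variable (P : OscillatorChain)

/-! ### Integration by parts against the Gibbs density

`ρ = e^{−H/T}`; `∂_{p_i} ρ = −(p_i/T) ρ`. All identities are for Lebesgue measure on phase space
with the weight `ρ` (the Gibbs MEASURE versions follow by dividing by `∫ρ`).
-/

section IBP

variable {P}

/-- Line derivative of a product `v · ρ` along `(0, e_i)`: `∂_{p_i}(vρ) = (∂_{p_i}v) ρ − v (p_i/T) ρ`.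
[folklore] -/
theorem hasLineDerivAt_mul_gibbsDensity {L : ℕ} {T : ℝ} {v : PhaseSpace L → ℝ}
    (hv : Differentiable ℝ v) (i : Fin L) (x : PhaseSpace L) :
    HasLineDerivAt ℝ (fun y => v y * P.gibbsDensity L T y)
      (partialP i v x * P.gibbsDensity L T x - v x * (x.2 i / T) * P.gibbsDensity L T x)
      x (uP i) := by
  have h1 := hasLineDerivAt_partialP hv i x
  have h2 := P.hasLineDerivAt_gibbsDensity (T := T) (P.hasLineDerivAt_hamiltonian_unitP L x i)
  unfold HasLineDerivAt at h1 h2 ⊢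
  refine (h1.mul h2).congr_deriv ?_
  simp only [zero_smul, add_zero]
  ring

/-- The momentum coordinate `p_i` is continuous on phase space. [folklore] -/
theorem continuous_snd_apply_phaseSpace {L : ℕ} (i : Fin L) :
    Continuous fun x : PhaseSpace L => x.2 i :=
  (continuous_apply i).comp continuous_snd

/-- **Green's identity for the thermostat, I** (`u ∈ C²`, `v ∈ C¹_c`, `T ≠ 0`):
`∫ (T∂²_{p_i}u − p_i∂_{p_i}u) v ρ = −T ∫ ∂_{p_i}u ∂_{p_i}v ρ`. [folklore] -/
theorem integral_ou_mul_eq (hU : ContDiff ℝ 1 P.U) (hV : ContDiff ℝ 1 P.V) {L : ℕ} {T : ℝ}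
    (hT : T ≠ 0) {u v : PhaseSpace L → ℝ} (hu : ContDiff ℝ 2 u) (hv : ContDiff ℝ 1 v)
    (hvc : HasCompactSupport v) (i : Fin L) :
    ∫ x, OU⟦T ; i ; u ; x⟧ * v x * P.gibbsDensity L T x =
      -T * ∫ x, partialP i u x * partialP i v x * P.gibbsDensity L T x := by
  have hud : Differentiable ℝ u := hu.differentiable two_ne_zero
  have hvd : Differentiable ℝ v := hv.differentiable one_ne_zero
  have hu1 : ContDiff ℝ 1 (partialP i u) := contDiff_partialP hu (by norm_num) i
  have hu1d : Differentiable ℝ (partialP i u) := hu1.differentiable one_ne_zero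
  have hρc : Continuous (P.gibbsDensity L T) :=
    P.continuous_gibbsDensity hU.continuous hV.continuous L T
  have hFc : Continuous (partialP i u) := hu1.continuous
  have hF'c : Continuous (partialP i (partialP i u)) := continuous_partialP hu1 one_ne_zero i
  have hgc : Continuous fun y => v y * P.gibbsDensity L T y := hv.continuous.mul hρc
  have hvpc : Continuous (partialP i v) := continuous_partialP hv one_ne_zero i
  have hg'c : Continuous fun y => partialP i v y * P.gibbsDensity L T y -
      v y * (y.2 i / T) * P.gibbsDensity L T y := by fun_prop
  have hgs : HasCompactSupport fun y => v y * P.gibbsDensity L T y := hvc.mul_right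
  have hg's : HasCompactSupport fun y => partialP i v y * P.gibbsDensity L T y -
      v y * (y.2 i / T) * P.gibbsDensity L T y :=
    ((hasCompactSupport_partialP hvd hvc i).mul_right).sub (hvc.mul_right.mul_right)
  have e := integral_mul_eq_neg_of_hasLineDerivAt (v := uP i) hFc hF'c hgc hg'c hgs hg's
    (fun x => hasLineDerivAt_partialP hu1d i x) (fun x => hasLineDerivAt_mul_gibbsDensity hvd i x)
  -- `e : ∫ ∂u (∂v ρ − v p/T ρ) = −∫ ∂²u (v ρ)`
  have e1 : ∫ x, partialP i u x * (partialP i v x * P.gibbsDensity L T x -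
      v x * (x.2 i / T) * P.gibbsDensity L T x) =
      (∫ x, partialP i u x * partialP i v x * P.gibbsDensity L T x) -
        T⁻¹ * ∫ x, x.2 i * partialP i u x * v x * P.gibbsDensity L T x := by
    rw [← integral_const_mul, ← integral_sub]
    · congr 1
      funext x
      field_simp
    · exact ((hFc.mul hvpc).mul hρc).integrable_of_hasCompactSupport
        ((hasCompactSupport_partialP hvd hvc i).mul_left.mul_right)
    · refine Integrable.const_mul ?_ _
      exact ((((continuous_snd_apply_phaseSpace i).mul hFc).mul hv.continuous).mul
        hρc).integrable_of_hasCompactSupport (hvc.mul_left.mul_right)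
  rw [e1] at e
  have e2 : ∫ x, OU⟦T ; i ; u ; x⟧ * v x * P.gibbsDensity L T x =
      T * (∫ x, partialP i (partialP i u) x * (v x * P.gibbsDensity L T x)) -
        ∫ x, x.2 i * partialP i u x * v x * P.gibbsDensity L T x := by
    rw [← integral_const_mul, ← integral_sub]
    · congr 1
      funext x
      ring
    · refine Integrable.const_mul ?_ _
      exact (hF'c.mul hgc).integrable_of_hasCompactSupport hgs.mul_left
    · exact ((((continuous_snd_apply_phaseSpace i).mul hFc).mul hv.continuous).mul
        hρc).integrable_of_hasCompactSupport (hvc.mul_left.mul_right)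
  rw [e2]
  have e3 : ∫ x, partialP i (partialP i u) x * (v x * P.gibbsDensity L T x) =
      -((∫ x, partialP i u x * partialP i v x * P.gibbsDensity L T x) -
        T⁻¹ * ∫ x, x.2 i * partialP i u x * v x * P.gibbsDensity L T x) := by
    linarith
  rw [e3]
  field_simp
  ring

/-- **Green's identity for the thermostat, II** (`u ∈ C¹`, `v ∈ C²_c`, `T ≠ 0`):
`∫ (T∂²_{p_i}v − p_i∂_{p_i}v) u ρ = −T ∫ ∂_{p_i}u ∂_{p_i}v ρ`. [folklore] -/
theorem integral_ou_mul_eq' (hU : ContDiff ℝ 1 P.U) (hV : ContDiff ℝ 1 P.V) {L : ℕ} {T : ℝ}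
    (hT : T ≠ 0) {u v : PhaseSpace L → ℝ} (hu : ContDiff ℝ 1 u) (hv : ContDiff ℝ 2 v)
    (hvc : HasCompactSupport v) (i : Fin L) :
    ∫ x, OU⟦T ; i ; v ; x⟧ * u x * P.gibbsDensity L T x =
      -T * ∫ x, partialP i u x * partialP i v x * P.gibbsDensity L T x := by
  have hud : Differentiable ℝ u := hu.differentiable one_ne_zero
  have hvd : Differentiable ℝ v := hv.differentiable two_ne_zero
  have hv1 : ContDiff ℝ 1 (partialP i v) := contDiff_partialP hv (by norm_num) i
  have hv1d : Differentiable ℝ (partialP i v) := hv1.differentiable one_ne_zero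
  have hρc : Continuous (P.gibbsDensity L T) :=
    P.continuous_gibbsDensity hU.continuous hV.continuous L T
  have hupc : Continuous (partialP i u) := continuous_partialP hu one_ne_zero i
  have hgc : Continuous (partialP i v) := hv1.continuous
  have hg'c : Continuous (partialP i (partialP i v)) := continuous_partialP hv1 one_ne_zero i
  have hgs : HasCompactSupport (partialP i v) := hasCompactSupport_partialP hvd hvc i
  have hg's : HasCompactSupport (partialP i (partialP i v)) := hasCompactSupport_partialP hv1d hgs i
  have hFc : Continuous fun y => u y * P.gibbsDensity L T y := hu.continuous.mul hρc
  have hF'c : Continuous fun y => partialP i u y * P.gibbsDensity L T y -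
      u y * (y.2 i / T) * P.gibbsDensity L T y := by
    have := continuous_snd_apply_phaseSpace (L := L) i
    fun_prop
  have e := integral_mul_eq_neg_of_hasLineDerivAt (v := uP i) hFc hF'c hgc hg'c hgs hg's
    (fun x => hasLineDerivAt_mul_gibbsDensity hud i x) (fun x => hasLineDerivAt_partialP hv1d i x)
  -- `e : ∫ (u ρ) ∂²v = −∫ (∂u ρ − u p/T ρ) ∂v`
  have e1 : ∫ x, (partialP i u x * P.gibbsDensity L T x - u x * (x.2 i / T) * P.gibbsDensity L T x) *
      partialP i v x =
      (∫ x, partialP i u x * partialP i v x * P.gibbsDensity L T x) -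
        T⁻¹ * ∫ x, x.2 i * partialP i v x * u x * P.gibbsDensity L T x := by
    rw [← integral_const_mul, ← integral_sub]
    · congr 1
      funext x
      field_simp
    · exact ((hupc.mul hgc).mul hρc).integrable_of_hasCompactSupport (hgs.mul_left.mul_right)
    · refine Integrable.const_mul ?_ _
      exact ((((continuous_snd_apply_phaseSpace i).mul hgc).mul hu.continuous).mul
        hρc).integrable_of_hasCompactSupport (hgs.mul_left.mul_right.mul_right)
  rw [e1] at e
  have e2 : ∫ x, OU⟦T ; i ; v ; x⟧ * u x * P.gibbsDensity L T x =
      T * (∫ x, u x * P.gibbsDensity L T x * partialP i (partialP i v) x) -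
        ∫ x, x.2 i * partialP i v x * u x * P.gibbsDensity L T x := by
    rw [← integral_const_mul, ← integral_sub]
    · congr 1
      funext x
      ring
    · refine Integrable.const_mul ?_ _
      exact (hFc.mul hg'c).integrable_of_hasCompactSupport hg's.mul_left
    · exact ((((continuous_snd_apply_phaseSpace i).mul hgc).mul hu.continuous).mul
        hρc).integrable_of_hasCompactSupport (hgs.mul_left.mul_right.mul_right)
  rw [e2, e]
  field_simp
  ring

/-- **Symmetry of the thermostat in `L²(ρ)`** (`u ∈ C²`, `v ∈ C²_c`, `T ≠ 0`):
`∫ (S_i u) v ρ = ∫ u (S_i v) ρ`. [folklore] -/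
theorem integral_ou_mul_comm (hU : ContDiff ℝ 1 P.U) (hV : ContDiff ℝ 1 P.V) {L : ℕ} {T : ℝ}
    (hT : T ≠ 0) {u v : PhaseSpace L → ℝ} (hu : ContDiff ℝ 2 u) (hv : ContDiff ℝ 2 v)
    (hvc : HasCompactSupport v) (i : Fin L) :
    ∫ x, OU⟦T ; i ; u ; x⟧ * v x * P.gibbsDensity L T x =
      ∫ x, u x * OU⟦T ; i ; v ; x⟧ * P.gibbsDensity L T x := by
  rw [integral_ou_mul_eq hU hV hT hu (hv.of_le (by norm_num)) hvc i,
    ← integral_ou_mul_eq' hU hV hT (hu.of_le (by norm_num)) hv hvc i]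
  congr 1
  funext x
  ring

/-- `X_H v` is continuous for `v ∈ C¹` and `C¹` potentials. [folklore] -/
theorem continuous_liouville (hU : ContDiff ℝ 1 P.U) (hV : ContDiff ℝ 1 P.V) {L : ℕ}
    {v : PhaseSpace L → ℝ} (hv : ContDiff ℝ 1 v) :
    Continuous fun x : PhaseSpace L => XH⟦P ; v ; x⟧ := by
  have hH1 : ContDiff ℝ 1 (P.hamiltonian L) := P.contDiff_hamiltonian hU hV L
  refine continuous_finsetSum _ fun i _ => ?_
  exact ((continuous_snd_apply_phaseSpace i).mul (continuous_partialQ hv one_ne_zero i)).sub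
    ((P.continuous_partialQ_hamiltonian hH1 i).mul (continuous_partialP hv one_ne_zero i))

/-- `X_H v` has compact support if `v ∈ C¹_c`. [folklore] -/
theorem hasCompactSupport_liouville {L : ℕ} {v : PhaseSpace L → ℝ} (hv : Differentiable ℝ v)
    (hvc : HasCompactSupport v) :
    HasCompactSupport fun x : PhaseSpace L => XH⟦P ; v ; x⟧ := by
  have hq : ∀ i : Fin L, HasCompactSupport (partialQ i v) := fun i =>
    hasCompactSupport_partialQ hv hvc i
  have hp : ∀ i : Fin L, HasCompactSupport (partialP i v) := fun i =>
    hasCompactSupport_partialP hv hvc i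
  simp only [hasCompactSupport_iff_eventuallyEq] at hq hp ⊢
  have hq' : ∀ᶠ x in Filter.coclosedCompact (PhaseSpace L), ∀ i, partialQ i v x = 0 :=
    Filter.eventually_all.mpr fun i => (hq i).mono fun x hx => hx
  have hp' : ∀ᶠ x in Filter.coclosedCompact (PhaseSpace L), ∀ i, partialP i v x = 0 :=
    Filter.eventually_all.mpr fun i => (hp i).mono fun x hx => hx
  filter_upwards [hq', hp'] with x hxq hxp
  simp [hxq, hxp]

/-- `S_i v` is continuous for `v ∈ C²`. [folklore] -/
theorem continuous_ou {L : ℕ} (T : ℝ) {v : PhaseSpace L → ℝ} (hv : ContDiff ℝ 2 v) (i : Fin L) :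
    Continuous fun x : PhaseSpace L => OU⟦T ; i ; v ; x⟧ := by
  have hv1 : ContDiff ℝ 1 (partialP i v) := contDiff_partialP hv (by norm_num) i
  exact (continuous_const.mul (continuous_partialP hv1 one_ne_zero i)).sub
    ((continuous_snd_apply_phaseSpace i).mul (continuous_partialP hv two_ne_zero i))

/-- `S_i v` has compact support if `v ∈ C²_c`. [folklore] -/
theorem hasCompactSupport_ou {L : ℕ} (T : ℝ) {v : PhaseSpace L → ℝ} (hv : ContDiff ℝ 2 v)
    (hvc : HasCompactSupport v) (i : Fin L) :
    HasCompactSupport fun x : PhaseSpace L => OU⟦T ; i ; v ; x⟧ := by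
  have hvd : Differentiable ℝ v := hv.differentiable two_ne_zero
  have hp : HasCompactSupport (partialP i v) := hasCompactSupport_partialP hvd hvc i
  have hpp : HasCompactSupport (partialP i (partialP i v)) :=
    hasCompactSupport_partialP (differentiable_partialP_of_contDiff_two hv i) hp i
  exact (hpp.mul_left).sub (hp.mul_left)

/-- `∫ (X_H φ) ρ = 0` for `φ ∈ C¹_c` (Liouville's theorem against the Gibbs weight, summed over
the sites). [folklore] -/
theorem integral_liouville_gibbsDensity (hU : ContDiff ℝ 1 P.U) (hV : ContDiff ℝ 1 P.V) (L : ℕ)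
    (T : ℝ) {φ : PhaseSpace L → ℝ} (hφ : ContDiff ℝ 1 φ) (hφc : HasCompactSupport φ) :
    ∫ x : PhaseSpace L, XH⟦P ; φ ; x⟧ * P.gibbsDensity L T x = 0 := by
  have hρc : Continuous (P.gibbsDensity L T) :=
    P.continuous_gibbsDensity hU.continuous hV.continuous L T
  have hH1 : ContDiff ℝ 1 (P.hamiltonian L) := P.contDiff_hamiltonian hU hV L
  simp only [Finset.sum_mul]
  rw [integral_finsetSum]
  · exact Finset.sum_eq_zero fun i _ => P.integral_liouville_mul_gibbsDensity hU hV L T hφ hφc i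
  · intro i _
    refine Continuous.integrable_of_hasCompactSupport ?_ ?_
    · exact (((continuous_snd_apply_phaseSpace i).mul (continuous_partialQ hφ one_ne_zero i)).sub
        ((P.continuous_partialQ_hamiltonian hH1 i).mul (continuous_partialP hφ one_ne_zero i))).mul hρc
    · exact (((hasCompactSupport_partialQ (hφ.differentiable one_ne_zero) hφc i).mul_left).sub
        ((hasCompactSupport_partialP (hφ.differentiable one_ne_zero) hφc i).mul_left)).mul_right

/-- `∫ (S_i φ) ρ = 0` for `φ ∈ C²_c` and `T ≠ 0` (fluctuation–dissipation: the thermostat at the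
Gibbs temperature preserves `ρ`). [folklore] -/
theorem integral_ou_gibbsDensity (hU : ContDiff ℝ 1 P.U) (hV : ContDiff ℝ 1 P.V) {L : ℕ}
    {T : ℝ} (hT : T ≠ 0) {φ : PhaseSpace L → ℝ} (hφ : ContDiff ℝ 2 φ) (hφc : HasCompactSupport φ)
    (i : Fin L) :
    ∫ x : PhaseSpace L, OU⟦T ; i ; φ ; x⟧ * P.gibbsDensity L T x = 0 := by
  have h := P.integral_bath_mul_gibbsDensity hU hV L T T hφ hφc i
  rw [div_self hT, sub_self, zero_mul] at h
  exact h

/-- **Antisymmetry of the Liouville operator in `L²(ρ)`** (`u ∈ C¹`, `v ∈ C¹_c`):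
`∫ (X_H u) v ρ = −∫ u (X_H v) ρ`. [folklore] -/
theorem integral_liouville_mul_eq (hU : ContDiff ℝ 1 P.U) (hV : ContDiff ℝ 1 P.V) (L : ℕ) (T : ℝ)
    {u v : PhaseSpace L → ℝ} (hu : ContDiff ℝ 1 u) (hv : ContDiff ℝ 1 v)
    (hvc : HasCompactSupport v) :
    ∫ x : PhaseSpace L, XH⟦P ; u ; x⟧ * v x * P.gibbsDensity L T x =
      -∫ x : PhaseSpace L, u x * XH⟦P ; v ; x⟧ * P.gibbsDensity L T x := by
  have hud : Differentiable ℝ u := hu.differentiable one_ne_zero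
  have hvd : Differentiable ℝ v := hv.differentiable one_ne_zero
  have hρc : Continuous (P.gibbsDensity L T) :=
    P.continuous_gibbsDensity hU.continuous hV.continuous L T
  have huv : ContDiff ℝ 1 fun y => u y * v y := hu.mul hv
  have huvc : HasCompactSupport fun y => u y * v y := hvc.mul_left
  -- the Liouville identity for the compactly supported product `u v`, summed over the sites
  have hsum : ∫ x : PhaseSpace L, XH⟦P ; fun y => u y * v y ; x⟧ * P.gibbsDensity L T x = 0 :=
    integral_liouville_gibbsDensity hU hV L T huv huvc
  have hexp : (fun x : PhaseSpace L => XH⟦P ; fun y => u y * v y ; x⟧ * P.gibbsDensity L T x) =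
      fun x => u x * XH⟦P ; v ; x⟧ * P.gibbsDensity L T x +
        XH⟦P ; u ; x⟧ * v x * P.gibbsDensity L T x := by
    funext x
    rw [liouville_mul P hud hvd]
    ring
  rw [hexp, integral_add] at hsum
  · linarith
  · exact ((hu.continuous.mul (continuous_liouville hU hV hv)).mul hρc).integrable_of_hasCompactSupport
      ((hasCompactSupport_liouville (P := P) hvd hvc).mul_left.mul_right)
  · exact (((continuous_liouville hU hV hu).mul hv.continuous).mul hρc).integrable_of_hasCompactSupport
      (hvc.mul_left.mul_right)

/-- **Gaussian integration by parts against a `p_i`-independent weight.** For `ψ ∈ C²_c`,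
`T ≠ 0` and any `F` invariant under translations of `p_i` with `F ρ ∈ L¹`:
`∫ (T∂²_{p_i}ψ − p_i∂_{p_i}ψ) F ρ = 0` (no regularity of `F` is needed: its line derivative
along `(0, e_i)` vanishes identically). This is what makes `S_K` orthogonal to the range of the
conditional expectation `Π_K`. [folklore] -/
theorem integral_ou_mul_invariant (hU : ContDiff ℝ 1 P.U) (hV : ContDiff ℝ 1 P.V) {L : ℕ}
    {T : ℝ} (hT : T ≠ 0) {ψ : PhaseSpace L → ℝ} (hψ : ContDiff ℝ 2 ψ) (hψc : HasCompactSupport ψ)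
    (i : Fin L) {F : PhaseSpace L → ℝ} (hF : ∀ (x : PhaseSpace L) (t : ℝ), F (x + t • uP i) = F x)
    (hFi : Integrable fun x => F x * P.gibbsDensity L T x) :
    ∫ x : PhaseSpace L, OU⟦T ; i ; ψ ; x⟧ * F x * P.gibbsDensity L T x = 0 := by
  haveI := isAddHaarMeasure_volume_phaseSpace L
  have hψd : Differentiable ℝ ψ := hψ.differentiable two_ne_zero
  have hψ1 : ContDiff ℝ 1 (partialP i ψ) := contDiff_partialP hψ (by norm_num) i
  have hψ1d : Differentiable ℝ (partialP i ψ) := hψ1.differentiable one_ne_zero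
  have hρc : Continuous (P.gibbsDensity L T) :=
    P.continuous_gibbsDensity hU.continuous hV.continuous L T
  have hpc : Continuous (partialP i ψ) := hψ1.continuous
  have hppc : Continuous (partialP i (partialP i ψ)) := continuous_partialP hψ1 one_ne_zero i
  have hps : HasCompactSupport (partialP i ψ) := hasCompactSupport_partialP hψd hψc i
  have hpps : HasCompactSupport (partialP i (partialP i ψ)) := hasCompactSupport_partialP hψ1d hps i
  -- the bounded compactly supported factors
  set b : PhaseSpace L → ℝ := fun x => partialP i (partialP i ψ) x - partialP i ψ x * (x.2 i / T)
    with hb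
  have hbc : Continuous b := by
    have := continuous_snd_apply_phaseSpace (L := L) i
    simp only [hb]; fun_prop
  have hbs : HasCompactSupport b := hpps.sub (hps.mul_right)
  obtain ⟨Cb, hCb⟩ := hbc.bounded_above_of_compact_support hbs
  obtain ⟨Cp, hCp⟩ := hpc.bounded_above_of_compact_support hps
  have hfg' : Integrable fun x => F x * (partialP i (partialP i ψ) x * P.gibbsDensity L T x -
      partialP i ψ x * (x.2 i / T) * P.gibbsDensity L T x) := by
    have h := hFi.mul_bdd hbc.aestronglyMeasurable (ae_of_all _ hCb)
    refine h.congr (ae_of_all _ fun x => ?_)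
    simp only [hb]
    ring
  have hfg : Integrable fun x => F x * (partialP i ψ x * P.gibbsDensity L T x) := by
    have h := hFi.mul_bdd hpc.aestronglyMeasurable (ae_of_all _ hCp)
    refine h.congr (ae_of_all _ fun x => ?_)
    ring
  have e := integral_bilinear_hasLineDerivAt_right_eq_neg_left_of_integrable
    (μ := (volume : Measure (PhaseSpace L))) (B := ContinuousLinearMap.mul ℝ ℝ)
    (f := F) (f' := fun _ => (0 : ℝ)) (g := fun x => partialP i ψ x * P.gibbsDensity L T x)
    (g' := fun x => partialP i (partialP i ψ) x * P.gibbsDensity L T x -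
      partialP i ψ x * (x.2 i / T) * P.gibbsDensity L T x) (v := uP i)
    (by simp) (by simpa using hfg') (by simpa using hfg)
    (fun x _ => by
      unfold HasLineDerivAt
      have : (fun t : ℝ => F (x + t • uP i)) = fun _ => F x := funext fun t => hF x t
      rw [this]
      exact hasDerivAt_const _ _)
    (fun x _ => hasLineDerivAt_mul_gibbsDensity hψ1d i x)
  simp only [ContinuousLinearMap.mul_apply', zero_mul, integral_zero, neg_zero] at e
  have key : (fun x : PhaseSpace L => OU⟦T ; i ; ψ ; x⟧ * F x * P.gibbsDensity L T x) =
      fun x => T * (F x * (partialP i (partialP i ψ) x * P.gibbsDensity L T x -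
        partialP i ψ x * (x.2 i / T) * P.gibbsDensity L T x)) := by
    funext x
    field_simp
  rw [key, integral_const_mul, e, mul_zero]

end IBP

/-- Registered helper stub of this support file: Gaussian integration by parts of the thermostat against a `p_i`-translation-invariant weight. [folklore] -/
theorem helper_insertionIBP : ∀ {P : OscillatorChain}, ContDiff ℝ 1 P.U → ContDiff ℝ 1 P.V → ∀ {L : ℕ} {T : ℝ}, T ≠ 0 → ∀ {ψ : PhaseSpace L → ℝ}, ContDiff ℝ 2 ψ → HasCompactSupport ψ → ∀ (i : Fin L) {F : PhaseSpace L → ℝ}, (∀ (x : PhaseSpace L) (t : ℝ), F (x + t • ((0, Pi.single i 1) : PhaseSpace L)) = F x) → Integrable (fun x => F x * P.gibbsDensity L T x) → ∫ x : PhaseSpace L, (T * partialP i (partialP i ψ) x - x.2 i * partialP i ψ x) * F x * P.gibbsDensity L T x = 0 := by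
  intro P hU hV L T hT ψ hψ hψc i F hF hFi
  exact integral_ou_mul_invariant hU hV hT hψ hψc i hF hFi

end Summit.AtomisticToContinuum.FouriersLaw.Cruxes.SuperadditiveResistance.InsertionToolbox

end
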